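import Summits.Parity.GeneralizedHardyLittlewood.Theorems.LeeYangFibresRelativeDimOneMoebiusSplitSingularSeriesAux4
import Summits.Parity.GeneralizedHardyLittlewood.Theorems.LeeYangFibresRelativeDimOneMoebiusSplitSingularSeriesAux6
import HarnessLib

/-!
# Crux `RelativeDimOne` (stmt-Parity-14113), line `single-moebius-split`, stub `stub_tssInduction`:
# auxiliary file 7 — the main terms of the induction step (one-variable lemma with frozen primes)

Induction step `t → t + 1` of `TSSInduction`, part 2. After peeling the last variable `x` (`tssI_gySum_peel`)
and replacing each inner `t`-variable sum by its main term `∏_{p<y} β_p(W^{(x)}, Z')`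
`= ∏_{p<y} (A_p 1_{p∣x} + B_p 1_{p∤x})` (`TSSInd.gyLocalFactor_cond`), the resulting one-variable sum

  `∑_{x ≤ R_t} μ(x) log(R_t/x) ∏_{p<y} (A_p 1_{p∣x} + B_p 1_{p∤x})`
  `= Π_B · ∑_{x ≤ R_t} μ(x) log(R_t/x) (∏_{p∣x, p∉P} A_p/B_p) ∏_{p∈P}(A_p 1_{p∣x} + B_p 1_{p∤x})`,
  `Π_B = ∏_{p<y, p∉P} B_p` (`TSSInd.prod_ite_dvd_split`),

is the sum of the one-variable lemma with frozen primes `tss_ovl` (twist `w(p) = A_p/B_p`: generic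
`|p w(p) − 1| ≤ (2t+2)/p`, rough `|p w(p)| ≤ 2`, `TSSInd.twist_generic/rough`), whose main term recombines
prime by prime to `∏_{p<y} β^{t+1}_p(W, Z)` (`TSSInd.prod_B_mul_prod_E`, `TSSInd.gyLocalFactor_succ`), while
`0 ≤ Π_B ≤ ∏_{p∈Q} (p/(p−1))^{t+1}` (generic `B_p ≤ 1` by Bernoulli) and
`∏_{p∈P}(|A_p| + |B_p|) ≤ 2^{(t+1)|P|} ∏_{p∈P} |W_p|/p`: this is `tssI_main` (registered).

References: D. A. Goldston, C. Y. Yıldırım, Integers 3 (2003) A5 = arXiv:math/0111212, Lemma 2.1, §3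
[GoldstonYildirim2001].
-/

noncomputable section

open Finset Real
open scoped BigOperators

namespace Summit.Parity.GeneralizedHardyLittlewood.Cruxes.RelativeDimOne.SingleMoebiusSplit

namespace TSSInd

/-! ### Factorisation of the main part along frozen / non-frozen primes -/

/-- For `1 ≤ x < y`, `P ⊆ {p < y}` and `B_p ≠ 0` off `P`:
`∏_{p<y} (A_p 1_{p∣x} + B_p 1_{p∤x}) = (∏_{p<y, p∉P} B_p) · (∏_{p ∣ x, p ∉ P} A_p/B_p) · ∏_{p∈P} (A_p 1_{p∣x} + B_p 1_{p∤x})`.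
[folklore] -/
theorem prod_ite_dvd_split (A B : ℕ → ℝ) {P : Finset ℕ} {x y : ℕ} (hx : x ≠ 0) (hxy : x < y)
    (hP : P ⊆ Nat.primesBelow y) (hB : ∀ p ∈ Nat.primesBelow y, p ∉ P → B p ≠ 0) :
    ∏ p ∈ Nat.primesBelow y, (if p ∣ x then A p else B p) =
      (∏ p ∈ Nat.primesBelow y \ P, B p) *
        ((∏ p ∈ x.primeFactors \ P, A p / B p) * ∏ p ∈ P, (if p ∣ x then A p else B p)) := by
  rw [← Finset.prod_sdiff hP]
  have hkey : ∏ p ∈ Nat.primesBelow y \ P, (if p ∣ x then A p else B p) =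
      (∏ p ∈ Nat.primesBelow y \ P, B p) * ∏ p ∈ x.primeFactors \ P, A p / B p := by
    have h1 : ∀ p ∈ Nat.primesBelow y \ P, (if p ∣ x then A p else B p) =
        B p * (if p ∣ x then A p / B p else 1) := by
      intro p hp
      obtain ⟨hp1, hp2⟩ := Finset.mem_sdiff.1 hp
      split_ifs with h
      · rw [mul_div_cancel₀ _ (hB p hp1 hp2)]
      · rw [mul_one]
    rw [Finset.prod_congr rfl h1, Finset.prod_mul_distrib, ← Finset.prod_filter]
    congr 1
    refine Finset.prod_congr ?_ fun _ _ => rfl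
    ext p
    simp only [Finset.mem_filter, Finset.mem_sdiff, Nat.mem_primesBelow, Nat.mem_primeFactors, ne_eq]
    constructor
    · rintro ⟨⟨⟨_, hp⟩, hnP⟩, hdvd⟩
      exact ⟨⟨hp, hdvd, hx⟩, hnP⟩
    · rintro ⟨⟨hp, hdvd, -⟩, hnP⟩
      have hpy : p < y := lt_of_le_of_lt (Nat.le_of_dvd (Nat.pos_of_ne_zero hx) hdvd) hxy
      exact ⟨⟨⟨hpy, hp⟩, hnP⟩, hdvd⟩
  rw [hkey]
  ring

/-- Prime-by-prime recombination of the local factors: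
`(∏_{p<y, p∉P} B_p) · ∏_{p<y} E_p = ∏_{p<y} (p/(p−1)) (B_p − A_p)` with `E_p = (B_p − A_p) p/(p−1)` on `P` and
`(1 − w(p)) p/(p−1)`, `w(p) = A_p/B_p`, off `P`. [folklore] -/
theorem prod_B_mul_prod_E (A B w : ℕ → ℝ) {P : Finset ℕ} {y : ℕ} (hP : P ⊆ Nat.primesBelow y)
    (hB : ∀ p ∈ Nat.primesBelow y, p ∉ P → B p ≠ 0)
    (hw : ∀ p ∈ Nat.primesBelow y, p ∉ P → w p = A p / B p) :
    (∏ p ∈ Nat.primesBelow y \ P, B p) *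
        ∏ p ∈ Nat.primesBelow y, (if p ∈ P then (B p - A p) else (1 - w p)) * ((p : ℝ) / ((p : ℝ) - 1)) =
      ∏ p ∈ Nat.primesBelow y, (p : ℝ) / ((p : ℝ) - 1) * (B p - A p) := by
  rw [← Finset.prod_sdiff hP, ← Finset.prod_sdiff hP (f := fun p : ℕ => (p : ℝ) / ((p : ℝ) - 1) * (B p - A p))]
  have h1 : ∏ p ∈ P, (if p ∈ P then (B p - A p) else (1 - w p)) * ((p : ℝ) / ((p : ℝ) - 1)) =
      ∏ p ∈ P, (p : ℝ) / ((p : ℝ) - 1) * (B p - A p) :=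
    Finset.prod_congr rfl fun p hp => by rw [if_pos hp]; ring
  have h2 : (∏ p ∈ Nat.primesBelow y \ P, B p) *
      ∏ p ∈ Nat.primesBelow y \ P, (if p ∈ P then (B p - A p) else (1 - w p)) * ((p : ℝ) / ((p : ℝ) - 1)) =
      ∏ p ∈ Nat.primesBelow y \ P, (p : ℝ) / ((p : ℝ) - 1) * (B p - A p) := by
    rw [← Finset.prod_mul_distrib]
    refine Finset.prod_congr rfl fun p hp => ?_
    obtain ⟨hp1, hp2⟩ := Finset.mem_sdiff.1 hp
    rw [if_neg hp2, hw p hp1 hp2]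
    have := hB p hp1 hp2
    field_simp
  rw [h1, ← h2]
  ring

/-! ### Products of reals over sub-families -/

/-- `∏_{s} f ≤ ∏_{t} f` for `s ⊆ t`, `f ≥ 0` on `s` and `f ≥ 1` on `t ∖ s`. [folklore] -/
theorem prod_le_prod_of_subset {s u : Finset ℕ} {f : ℕ → ℝ} (h : s ⊆ u) (hf0 : ∀ i ∈ s, 0 ≤ f i)
    (hf1 : ∀ i ∈ u, i ∉ s → 1 ≤ f i) : ∏ i ∈ s, f i ≤ ∏ i ∈ u, f i := by
  rw [← Finset.prod_sdiff h]
  refine le_mul_of_one_le_left (Finset.prod_nonneg hf0) (Finset.one_le_prod fun i hi => ?_)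
  obtain ⟨hi1, hi2⟩ := Finset.mem_sdiff.1 hi
  exact hf1 i hi1 hi2

/-! ### The size of `Π_B` -/

/-- `0 ≤ Π_B = ∏_{p<y, p∉P} B_p ≤ ∏_{p ∈ Q} (p/(p−1))^{t+1}`: generic factors lie in `[0, 1]`, rough ones are
`≤ (p/(p−1))^t`. [folklore] -/
theorem prod_B_le {t : ℕ} (W : ℕ → Finset ℕ) (Z : ℕ → Fin (t + 1) → Finset ℕ) (P Q : Finset ℕ) (y : ℕ)
    (hQ : ∀ p ∈ Q, p.Prime)
    (hoff : ∀ p : ℕ, p.Prime → p ∉ P → W p = Finset.range p ∧ 2 * (t + 1) < p ∧ ∀ i, (Z p i).card ≤ 1)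
    (hgen : ∀ p : ℕ, p.Prime → p ∉ P → p ∉ Q →
      ∀ i : Fin (t + 1), ∃ r : ℕ, r < p ∧ Z p i = {r} ∧ ∀ j : Fin (t + 1), j ≠ i → r ∉ Z p j) :
    ∏ p ∈ Nat.primesBelow y \ P, gyLocalFactor W (fun q i => Z q (Fin.castSucc i)) p ≤
      ∏ p ∈ Q, ((p : ℝ) / ((p : ℝ) - 1)) ^ (t + 1) := by
  calc ∏ p ∈ Nat.primesBelow y \ P, gyLocalFactor W (fun q i => Z q (Fin.castSucc i)) p
      ≤ ∏ p ∈ Nat.primesBelow y \ P, (if p ∈ Q then ((p : ℝ) / ((p : ℝ) - 1)) ^ (t + 1) else 1) := by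
        refine Finset.prod_le_prod (fun p _ => gyLocalFactor_nonneg _ _ _) fun p hp => ?_
        obtain ⟨hp1, hpP⟩ := Finset.mem_sdiff.1 hp
        have hp := (Nat.mem_primesBelow.1 hp1).2
        obtain ⟨hW, htp, -⟩ := hoff p hp hpP
        by_cases hpQ : p ∈ Q
        · rw [if_pos hpQ, pow_succ]
          refine (B_le W Z hW).trans (le_mul_of_one_le_right (pow_nonneg (div_pred_nonneg p) _) ?_)
          have h := TSSPeel.one_le_div_pred_pow hp.two_le 1
          rwa [pow_one] at h
        · rw [if_neg hpQ]
          exact B_le_one_generic W Z hW hp.two_le (by omega) (hgen p hp hpP hpQ)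
    _ = ∏ p ∈ (Nat.primesBelow y \ P).filter (fun p => p ∈ Q), ((p : ℝ) / ((p : ℝ) - 1)) ^ (t + 1) :=
        (Finset.prod_filter _ _).symm
    _ ≤ ∏ p ∈ Q, ((p : ℝ) / ((p : ℝ) - 1)) ^ (t + 1) :=
        prod_le_prod_of_subset (fun p hp => (Finset.mem_filter.1 hp).2)
          (fun p _ => pow_nonneg (div_pred_nonneg p) _) fun p hp _ => TSSPeel.one_le_div_pred_pow (hQ p hp).two_le _

/-- `∏_{p∈P} (|A_p| + |B_p|) ≤ 2^{(t+1)|P|} ∏_{p∈P} |W_p|/p` for a set of primes `P`. [folklore] -/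
theorem prod_abs_add_abs_le {t : ℕ} (W : ℕ → Finset ℕ) (Z : ℕ → Fin (t + 1) → Finset ℕ) (P : Finset ℕ)
    (hP : ∀ p ∈ P, p.Prime) :
    ∏ p ∈ P, (|gyLocalFactor (fun q => (W q).filter (fun r => r ∈ Z q (Fin.last t)))
        (fun q i => Z q (Fin.castSucc i)) p| + |gyLocalFactor W (fun q i => Z q (Fin.castSucc i)) p|) ≤
      (2 ^ (t + 1)) ^ P.card * ∏ p ∈ P, ((((W p).card : ℕ) : ℝ) / p) := by
  rw [← Finset.prod_const, ← Finset.prod_mul_distrib]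
  exact Finset.prod_le_prod (fun p _ => by positivity) fun p hp => abs_add_abs_le W Z (hP p hp).two_le

end TSSInd

/-! ### The registered sub-goal of this file: the main terms of the induction step -/

open TSSInd in
/-- **The main terms of the induction step** (sub-goal `tssI_main` of `stub_tssInduction`). There is an absolute
`c > 0` and, for all `t` and `B ≥ 0`, a constant `C` with: for window/root data `(W, Z)` on `t + 1` forms, frozen
primes `P` and rough primes `Q` as in `TSSInduction (t+1)`, a level `R ≥ 8` with `(∏P)³ ≤ R²`, `|Q| ≤ B log R`,
and `y > R` above `P`,
`|∑_{x ≤ R} μ(x) log(R/x) ∏_{p<y} β_p(W^{(x)}, Z') − ∏_{p<y} β_p(W, Z)| ≤ C 2^{(t+1)|P|} (∏_{p∈Q}(p/(p−1))^{t+1}) (∏_{p∈P} |W_p|/p) e^{−c√log R}`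
(the one-variable lemma with frozen primes `tss_ovl` for the twist `A_p/B_p`, times `Π_B`).
[cite: GoldstonYildirim2001, Lemma 2.1] -/
theorem tssI_main : ∃ c : ℝ, 0 < c ∧ ∀ (t : ℕ) (B : ℝ), 0 ≤ B → ∃ C : ℝ, 0 ≤ C ∧
    ∀ (W : ℕ → Finset ℕ) (Z : ℕ → Fin (t + 1) → Finset ℕ) (P Q : Finset ℕ) (RL : ℝ) (y : ℕ),
      (∀ p ∈ P, p.Prime) → (∀ p ∈ Q, p.Prime) →
      (∀ p : ℕ, p.Prime → p ∉ P → W p = Finset.range p ∧ 2 * (t + 1) < p ∧ ∀ i, (Z p i).card ≤ 1) →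
      (∀ p : ℕ, p.Prime → p ∉ P → p ∉ Q →
        ∀ i : Fin (t + 1), ∃ r : ℕ, r < p ∧ Z p i = {r} ∧ ∀ j : Fin (t + 1), j ≠ i → r ∉ Z p j) →
      8 ≤ RL → (∏ p ∈ P, (p : ℝ)) ^ 3 ≤ RL ^ 2 → (Q.card : ℝ) ≤ B * Real.log RL →
      ⌊RL⌋₊ < y → (∀ p ∈ P, p < y) →
        |(∑ x ∈ Finset.Icc 1 ⌊RL⌋₊, ((ArithmeticFunction.moebius x : ℤ) : ℝ) * Real.log (RL / x) *
            ∏ p ∈ Nat.primesBelow y,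
              gyLocalFactor (fun q => if q ∣ x then (W q).filter (fun r => r ∈ Z q (Fin.last t)) else W q)
                (fun q i => Z q (Fin.castSucc i)) p) -
          ∏ p ∈ Nat.primesBelow y, gyLocalFactor W Z p| ≤
        C * (2 ^ (t + 1)) ^ P.card * (∏ p ∈ Q, ((p : ℝ) / ((p : ℝ) - 1)) ^ (t + 1)) *
          (∏ p ∈ P, ((((W p).card : ℕ) : ℝ) / p)) * Real.exp (-(c * Real.sqrt (Real.log RL))) := by
  obtain ⟨c, hc, hC⟩ := tss_ovl
  refine ⟨c, hc, fun t B hB => ?_⟩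
  obtain ⟨C, hC0, hovl⟩ := hC (2 * t + 2) B hB
  refine ⟨C, hC0, ?_⟩
  intro W Z P Q RL y hP hQ hoff hgen hRL hPR hQc hy hPy
  -- the frozen data and the twist
  set Af : ℕ → ℝ := fun p => gyLocalFactor (fun q => (W q).filter (fun r => r ∈ Z q (Fin.last t)))
    (fun q i => Z q (Fin.castSucc i)) p with hAf
  set Bf : ℕ → ℝ := fun p => gyLocalFactor W (fun q i => Z q (Fin.castSucc i)) p with hBf
  set w : ℕ → ℝ := fun p => if p ∈ P then 0 else Af p / Bf p with hw
  have hPsub : P ⊆ Nat.primesBelow y := fun p hp => Nat.mem_primesBelow.2 ⟨hPy p hp, hP p hp⟩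
  have hBne : ∀ p ∈ Nat.primesBelow y, p ∉ P → Bf p ≠ 0 := fun p hp hpP => by
    obtain ⟨hW, htp, hZ⟩ := hoff p (Nat.mem_primesBelow.1 hp).2 hpP
    exact (B_pos W Z hW (Nat.mem_primesBelow.1 hp).2.two_le (by omega) hZ).ne'
  have hwP : ∀ p ∈ Nat.primesBelow y, p ∉ P → w p = Af p / Bf p := fun p _ hpP => by
    simp only [hw, if_neg hpP]
  -- `Π_B`
  set PiB := ∏ p ∈ Nat.primesBelow y \ P, Bf p with hPiB
  have hPiB0 : 0 ≤ PiB := Finset.prod_nonneg fun p _ => gyLocalFactor_nonneg _ _ _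
  -- the summands
  have hsummand : ∀ x ∈ Finset.Icc 1 ⌊RL⌋₊,
      ((ArithmeticFunction.moebius x : ℤ) : ℝ) * Real.log (RL / x) * ∏ p ∈ Nat.primesBelow y,
        gyLocalFactor (fun q => if q ∣ x then (W q).filter (fun r => r ∈ Z q (Fin.last t)) else W q)
          (fun q i => Z q (Fin.castSucc i)) p =
      PiB * (((ArithmeticFunction.moebius x : ℤ) : ℝ) * Real.log (RL / x) * (∏ p ∈ x.primeFactors \ P, w p) *
        (∏ p ∈ P, if p ∣ x then Af p else Bf p)) := by
    intro x hx
    have hx1 : 1 ≤ x := (Finset.mem_Icc.1 hx).1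
    have hxy : x < y := lt_of_le_of_lt (Finset.mem_Icc.1 hx).2 hy
    have hprod : ∏ p ∈ Nat.primesBelow y,
        gyLocalFactor (fun q => if q ∣ x then (W q).filter (fun r => r ∈ Z q (Fin.last t)) else W q)
          (fun q i => Z q (Fin.castSucc i)) p = ∏ p ∈ Nat.primesBelow y, (if p ∣ x then Af p else Bf p) :=
      Finset.prod_congr rfl fun p _ => gyLocalFactor_cond W Z p x
    have hwprod : ∏ p ∈ x.primeFactors \ P, w p = ∏ p ∈ x.primeFactors \ P, Af p / Bf p :=
      Finset.prod_congr rfl fun p hp => by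
        obtain ⟨-, hpP⟩ := Finset.mem_sdiff.1 hp
        simp only [hw, if_neg hpP]
    rw [hprod, prod_ite_dvd_split Af Bf (by omega) hxy hPsub hBne, hwprod]
    ring
  have hmainprod : ∏ p ∈ Nat.primesBelow y, gyLocalFactor W Z p =
      PiB * ∏ p ∈ Nat.primesBelow y, (if p ∈ P then (Bf p - Af p) else (1 - w p)) * ((p : ℝ) / ((p : ℝ) - 1)) := by
    rw [hPiB, prod_B_mul_prod_E Af Bf w hPsub hBne hwP]
    exact Finset.prod_congr rfl fun p _ => gyLocalFactor_succ W Z p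
  rw [Finset.sum_congr rfl hsummand, ← Finset.mul_sum, hmainprod, ← mul_sub, abs_mul, abs_of_nonneg hPiB0]
  -- the hypotheses of the one-variable lemma
  have hgen' : ∀ p : ℕ, p.Prime → p ∉ P → p ∉ Q → |(p : ℝ) * w p - 1| ≤ ((2 * t + 2 : ℕ) : ℝ) / p := by
    intro p hp hpP hpQ
    obtain ⟨hW, htp, hZ⟩ := hoff p hp hpP
    simp only [hw, if_neg hpP]
    exact twist_generic W Z hW hp.two_le htp hZ (hgen p hp hpP hpQ)
  have hrough : ∀ p ∈ Q, |(p : ℝ) * w p| ≤ ((2 * t + 2 : ℕ) : ℝ) := by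
    intro p hpQ
    by_cases hpP : p ∈ P
    · simp only [hw, if_pos hpP, mul_zero, abs_zero]
      positivity
    · obtain ⟨hW, htp, hZ⟩ := hoff p (hQ p hpQ) hpP
      simp only [hw, if_neg hpP]
      refine (twist_rough W Z hW (hQ p hpQ).two_le (by omega) hZ).trans ?_
      have h0 : (0 : ℝ) ≤ t := Nat.cast_nonneg t
      push_cast
      linarith
  have hov := hovl w Af Bf P Q hP hQ hgen' hrough RL hRL hPR hQc y hy hPy
  -- the bounds
  have hPiB_le : PiB ≤ ∏ p ∈ Q, ((p : ℝ) / ((p : ℝ) - 1)) ^ (t + 1) := prod_B_le W Z P Q y hQ hoff hgen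
  have hfrozen : ∏ p ∈ P, (|Af p| + |Bf p|) ≤ (2 ^ (t + 1)) ^ P.card * ∏ p ∈ P, ((((W p).card : ℕ) : ℝ) / p) :=
    prod_abs_add_abs_le W Z P hP
  have hΘ0 : 0 ≤ ∏ p ∈ Q, ((p : ℝ) / ((p : ℝ) - 1)) ^ (t + 1) :=
    Finset.prod_nonneg fun p _ => pow_nonneg (div_pred_nonneg p) _
  have hE0 : 0 ≤ Real.exp (-(c * Real.sqrt (Real.log RL))) := Real.exp_nonneg _
  have hW0 : 0 ≤ ∏ p ∈ P, ((((W p).card : ℕ) : ℝ) / p) :=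
    Finset.prod_nonneg fun p _ => div_nonneg (Nat.cast_nonneg _) (Nat.cast_nonneg _)
  calc PiB * |(∑ x ∈ Finset.Icc 1 ⌊RL⌋₊, ((ArithmeticFunction.moebius x : ℤ) : ℝ) * Real.log (RL / x) *
          (∏ p ∈ x.primeFactors \ P, w p) * (∏ p ∈ P, if p ∣ x then Af p else Bf p)) -
        ∏ p ∈ Nat.primesBelow y, (if p ∈ P then (Bf p - Af p) else (1 - w p)) * ((p : ℝ) / ((p : ℝ) - 1))|
      ≤ PiB * (C * (∏ p ∈ P, (|Af p| + |Bf p|)) * Real.exp (-(c * Real.sqrt (Real.log RL)))) :=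
        mul_le_mul_of_nonneg_left hov hPiB0
    _ ≤ (∏ p ∈ Q, ((p : ℝ) / ((p : ℝ) - 1)) ^ (t + 1)) *
          (C * ((2 ^ (t + 1)) ^ P.card * ∏ p ∈ P, ((((W p).card : ℕ) : ℝ) / p)) *
            Real.exp (-(c * Real.sqrt (Real.log RL)))) :=
        mul_le_mul hPiB_le (mul_le_mul_of_nonneg_right (mul_le_mul_of_nonneg_left hfrozen hC0) hE0)
          (by positivity) hΘ0
    _ = _ := by ring

end Summit.Parity.GeneralizedHardyLittlewood.Cruxes.RelativeDimOne.SingleMoebiusSplit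

end
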